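import Mathlib
import Literature.Geometry.Lorentzian.KerrTimelikeSpan
import Literature.Geometry.Lorentzian.TameGenericity

/-!
# Sketch — crux-ideate stmt-FinalStateConjecture-17639 (OmegaLimitMultiKerr), round 1, ideator 1

First lemmas of the two idea cards filed by this seat:

* §1 `eject-and-pay` — the abstract ONE-PASS / TOLL PRUNING lemma: a curve in a metric space carrying
  an antitone, bounded-below budget `L` that pays a fixed toll `δ` every time it passes from the
  `ε`-neighbourhood of a set `Z` to outside its `η`-neighbourhood is eventually `ε`-far from `Z` or
  eventually `η`-near `Z` (finitely many ejections). PROVED.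
* §2 `spinless-crumb` — the Kerr-parameter algebra behind "a spinless crumb de-extremalises and weak
  absorption cannot re-extremalise": at `|a| = M` the absorption inequality `Ω_H δJ ≤ δM` forces the
  first variation of the spin ratio `J/M²` to be `≤ 0`, strictly `< 0` for a spinless crumb
  (`δJ = 0 < δM`), while strictly inside `|a| < M` there is a spin-up window `2a < Ω_H⁻¹`. PROVED.
* §3 `spinless-crumb` — the LOCALISATION of tame witnesses (statement, as a named `Prop`): a tame,
  immersed family that is injective and exceptional-free only on a punctured parameter ball already
  yields `HasTameCodimAtLeastIn … 1` (reparametrise `ℝ → (−δ, δ)`); every witness construction on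
  this crux is local in `c`, so this is the formal entry point of the line.
-/

open Filter Set Metric Topology

set_option linter.dupNamespace false

namespace Summit.FinalStateConjecture.FinalStateConjecture.Cruxes.OmegaLimitMultiKerr.Ideator17639R1K1

/-! ## §1 One-pass / toll pruning (card `eject-and-pay`) -/

/-- **Toll pruning (abstract one-pass lemma).** `x` is a curve in a pseudometric space (the translated
era in the space of chart metrics), `L` an antitone budget bounded below by `m` (the two-boundary free
energy `M_B − √(A/16π)` read in chart time), `Z` a set (the orbit closure of a mode-unstable dark
object). If every passage from `infDist ≤ ε` to `infDist ≥ η` costs at least `δ > 0` of budget, then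
the curve is eventually `ε`-far from `Z` or eventually `η`-near `Z`. -/
theorem eventually_far_or_eventually_near {X : Type*} [PseudoMetricSpace X]
    (x : ℝ → X) (L : ℝ → ℝ) (Z : Set X) {ε η δ m : ℝ}
    (hL : Antitone L) (hm : ∀ t, m ≤ L t) (hδ : 0 < δ)
    (htoll : ∀ s t, s ≤ t → infDist (x s) Z ≤ ε → η ≤ infDist (x t) Z → L t ≤ L s - δ) :
    (∀ᶠ t in atTop, ε < infDist (x t) Z) ∨ (∀ᶠ t in atTop, infDist (x t) Z < η) := by
  by_contra h
  have h1 : ∀ a, ∃ b ≥ a, infDist (x b) Z ≤ ε := by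
    simpa [not_eventually, not_lt] using (not_or.mp h).1
  have h2 : ∀ a, ∃ b ≥ a, η ≤ infDist (x b) Z := by
    simpa [not_eventually, not_lt] using (not_or.mp h).2
  have key : ∀ n : ℕ, ∃ t, 0 ≤ t ∧ L t ≤ L 0 - n * δ := by
    intro n
    induction n with
    | zero => exact ⟨0, le_rfl, by simp⟩
    | succ n ih =>
      obtain ⟨t₀, ht₀, hLt₀⟩ := ih
      obtain ⟨s, hs, hsε⟩ := h1 t₀
      obtain ⟨t, ht, htη⟩ := h2 s
      refine ⟨t, by linarith, ?_⟩
      have h3 := htoll s t ht hsε htη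
      have hmono : L s ≤ L t₀ := hL hs
      push_cast
      linarith
  obtain ⟨n, hn⟩ := exists_nat_gt ((L 0 - m) / δ)
  obtain ⟨t, -, ht⟩ := key n
  have hmt := hm t
  have h4 : (n : ℝ) * δ ≤ L 0 - m := by linarith
  have h5 : (n : ℝ) ≤ (L 0 - m) / δ := by rwa [le_div_iff₀ hδ]
  linarith

/-- The form the line consumes: if `Z` is `ε`-approached at arbitrarily late times (i.e. `Z` meets
the `ε`-fattened ω-limit set of the era) then the era is eventually trapped in the `η`-neighbourhood
of `Z` — the THRESHOLD case, which is the only residue genericity must pay for. -/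
theorem eventually_near_of_frequently_near {X : Type*} [PseudoMetricSpace X]
    (x : ℝ → X) (L : ℝ → ℝ) (Z : Set X) {ε η δ m : ℝ}
    (hL : Antitone L) (hm : ∀ t, m ≤ L t) (hδ : 0 < δ)
    (htoll : ∀ s t, s ≤ t → infDist (x s) Z ≤ ε → η ≤ infDist (x t) Z → L t ≤ L s - δ)
    (hfreq : ∃ᶠ t in atTop, infDist (x t) Z ≤ ε) :
    ∀ᶠ t in atTop, infDist (x t) Z < η := by
  rcases eventually_far_or_eventually_near x L Z hL hm hδ htoll with h | h
  · exact absurd h (not_eventually.2 (hfreq.mono fun t ht ↦ not_lt.2 ht))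
  · exact h

/-! ## §2 Spin-ratio algebra at and near extremality (card `spinless-crumb`) -/

open Literature.Geometry.Lorentzian

/-- First variation of the spin ratio `J/M²` under `(δM, δJ)`: `δ(J/M²) = δJ/M² − 2J δM/M³`. -/
noncomputable def spinRatioVariation (M J δM δJ : ℝ) : ℝ := δJ / M ^ 2 - 2 * J * δM / M ^ 3

/-- At extremality `r₊ = M`. -/
theorem rPlus_extremal (M : ℝ) : Kerr.rPlus M M = M := by
  simp [Kerr.rPlus]

/-- At extremality the horizon angular velocity is `Ω_H = 1/(2M)`. -/
theorem horizonAngularVelocity_extremal {M : ℝ} (hM : 0 < M) :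
    Kerr.horizonAngularVelocity M M = 1 / (2 * M) := by
  unfold Kerr.horizonAngularVelocity
  rw [rPlus_extremal]
  field_simp

/-- **No spin-up at extremality by absorption.** If an absorbed flux `(δM, δJ)` obeys the
absorption (first-law / null-energy) inequality `Ω_H δJ ≤ δM` at the extremal parameters `a = M`
(`J = aM = M²`), then `δ(J/M²) ≤ 0`: weak absorbed radiation can only preserve or lower the spin
ratio of an extremal hole (Natário–Queimada–Vicente, CQG 33 (2016) 175002, the thermodynamic core). -/
theorem spinRatioVariation_nonpos_of_absorbed_extremal {M δM δJ : ℝ} (hM : 0 < M)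
    (habs : Kerr.horizonAngularVelocity M M * δJ ≤ δM) :
    spinRatioVariation M (M * M) δM δJ ≤ 0 := by
  rw [horizonAngularVelocity_extremal hM] at habs
  unfold spinRatioVariation
  have hM2 : 0 < M ^ 2 := by positivity
  have hM3 : 0 < M ^ 3 := by positivity
  have h1 : δJ ≤ 2 * M * δM := by
    have := habs
    rw [div_mul_eq_mul_div, one_mul, div_le_iff₀ (by positivity)] at this
    linarith
  have : δJ / M ^ 2 - 2 * (M * M) * δM / M ^ 3 = (δJ - 2 * M * δM) / M ^ 2 := by
    field_simp
    try ring
  rw [this]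
  exact div_nonpos_of_nonpos_of_nonneg (by linarith) hM2.le

/-- **A spinless crumb strictly de-extremalises**: `δJ = 0 < δM` at `a = M` gives
`δ(J/M²) = −2 δM / M < 0`. -/
theorem spinRatioVariation_neg_of_spinless {M δM : ℝ} (hM : 0 < M) (hδM : 0 < δM) :
    spinRatioVariation M (M * M) δM 0 < 0 := by
  unfold spinRatioVariation
  have : (0 : ℝ) / M ^ 2 - 2 * (M * M) * δM / M ^ 3 = -(2 * δM / M) := by
    field_simp
    try ring
  rw [this, neg_lt_zero]
  positivity

/-- **Strictly inside the sub-extremal range there IS a spin-up window**: for `0 < a < M`,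
`2a < Ω_H⁻¹ = 2Mr₊/a`, so absorbed modes with `2a < δJ/δM < Ω_H⁻¹` raise `J/M²` — the window closes
exactly at `a = M`. (This is why the card's margin argument is a THROTTLE, `√μ`-narrow, not a wall.) -/
theorem subextremal_spinup_window {M a : ℝ} (hM : 0 < M) (ha : 0 < a) (haM : a < M) :
    2 * a < (Kerr.horizonAngularVelocity M a)⁻¹ := by
  unfold Kerr.horizonAngularVelocity
  rw [inv_div]
  have hsq : 0 < √(M ^ 2 - a ^ 2) := Real.sqrt_pos.2 (by nlinarith)
  have hr : M < Kerr.rPlus M a := by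
    unfold Kerr.rPlus
    linarith
  rw [lt_div_iff₀ ha]
  nlinarith

/-! ## §3 Localisation of tame witnesses (card `spinless-crumb`, formal entry point) -/

open scoped Manifold ContDiff in
/-- **Tame witnesses are local in the parameter** (statement). If through every exceptional datum
there is a tame, immersed family which is injective and exceptional-free on a PUNCTURED BALL
`0 < ‖c‖ < δ` only, then the exceptional set has tame codimension `≥ 1`: reparametrise by a
diffeomorphism `ℝ → (−δ, δ)` fixing `0` with derivative `≠ 0` there (tameness, immersion at `0`,
`F 0 = d` and admissibility are preserved; injectivity and avoidance become global). Every witness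
construction on this crux (crumb, quarantine, kick) is of this local kind. -/
def TameWitnessLocalisation : Prop :=
  ∀ (X : Type) [TopologicalSpace X] [ChartedSpace E3 X] [IsManifold (𝓡 3) ∞ X]
    (𝓓 𝓔 : Set (InitialDataSet (𝓡 3) X)),
    (∀ d ∈ 𝓔, ∃ (e : AFEnd X) (F : EuclideanSpace ℝ (Fin 1) → InitialDataSet (𝓡 3) X) (δ : ℝ),
      0 < δ ∧ InitialDataSet.IsTameDataFamily e 1 F ∧ InitialDataSet.IsImmersedAtZero 1 F ∧
      F 0 = d ∧ Set.InjOn F (Metric.ball 0 δ) ∧ (∀ c, F c ∈ 𝓓) ∧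
      ∀ c, c ≠ 0 → ‖c‖ < δ → F c ∉ 𝓔) →
    InitialDataSet.HasTameCodimAtLeastIn 𝓓 𝓔 1

end Summit.FinalStateConjecture.FinalStateConjecture.Cruxes.OmegaLimitMultiKerr.Ideator17639R1K1
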